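import Summits.BirchSwinnertonDyer.BirchSwinnertonDyer.Theorems.PrintCf2SplitBadTwoStrictDatumOfUnrDatum
import Summits.BirchSwinnertonDyer.BirchSwinnertonDyer.Theorems.PrintCf2SplitBadTwoCMShaCocyclicOfCyclicTorsion
import HarnessLib

/-!
# Crux `PrintCf2.SplitBadTwoRankOneOfFacts` (stmt-BirchSwinnertonDyer-20368), skeleton v13, stub S3d `stub_strictDefectAtVbar_two` —
# the ALGEBRAIC SPINE, part III: the DICHOTOMY for the strict/unramified defect `Q = S_nr ⧸ 𝔖` embedded in a Prüfer-like local group —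
# an INFINITE `Q` is all of the local group, so `e_δ = χ(𝓗)`; a FINITE `Q` has `e_δ = 0` (part II)

Cell `bsd-print-cf2`, EXTRA WIDTH seat `bsd-line-cf2-p1-w3` g11 (prover-bsd-line-cf2-p1-w3-g11-0); `--supports stmt-BirchSwinnertonDyer-20368`
(helper, Theses-free). HONEST FRAMING: nothing here closes the crux or the registered stub S3d; BSD is not proved by any of this; no summit
statement is proved by this seat. No definition, no named fact, no `sorry`. Sequel of `PrintCf2SplitBadTwoDualPairKernel` (part I) and
`PrintCf2SplitBadTwoStrictDatumOfUnrDatum` (part II).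

WHY. On -w6 g4's class (iii) (`d ≡ 3 (8)` or `d ≡ 14 (16)`) the local defect group at the ONE place of `K*_∞` above `v̄` is
`Def = Hom_cont(D″/I″, W*) ≅ W*` — a PRÜFER-like group (every infinite subgroup is everything; tree pattern
`le_of_not_finite_of_cyclic_torsion`, -w2 g10) on which `γ'` acts through a unit `u` with `#W*[u − 1] = 4`, `(u − 1)W* = W*`. The quotient
`Q := S_{W*}(K*_∞) ⧸ 𝔖_{v̄}(K*_∞, W*)` embeds equivariantly in `Def`. Hence, by pure algebra, S3d's class value is decided by ONE bit:
`Q` infinite ⟹ `Q = Def` ⟹ `e_δ = χ(Def) = 2` (this file); `Q` finite ⟹ `e_δ = 0` (part II, `hasCharValuationAt_restricted_of_unr_of_finite`).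
The arithmetic input left for class (iii) is therefore «`Q` is infinite» (Greenberg–Vatsal Prop. 2.1-type surjectivity over the line, -w7 g5),
not an explicit isomorphism.
* §1 (groups) **`bijective_of_injective_of_not_finite`** — an injective `j : Q → H` into a group all of whose infinite subgroups are `⊤` is
  bijective as soon as `Q` is infinite; **`natCard_endInvariants_eq_of_injective_of_not_finite`** — then, for equivariant endomorphisms,
  `#Q^{ψ_Q} = #H^{ψ_H}` and `#Q_{ψ_Q} = #H_{ψ_H}` (part II `natCard_endInvariants_congr`).
* §2 (the line) **`hasCharValuationAt_restricted_of_unr_of_injective_of_not_finite`** — spine hypotheses of part II + an equivariant injection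
  `Q ↪ H` into a Prüfer-like `H` + `¬ Finite Q` ⟹ `Module.Finite D.X`, `D.HasCharValuationAt n`, `H^{ψ_H}`, `H_{ψ_H}` finite,
  `v_p #H^{ψ_H} = e + v_p #H_{ψ_H}`, **`ord_p H'(0) = n + e`**; CM-summand instance **`…_endEigenPrimaryTorsion`**.
presearch: Greenberg–Vatsal 2000 §2 Cor. 2.3 (the quotient `S^{Σ₀}/S` IS the local group under surjectivity) — source pattern; no new fact.
beyond-print theorem: no.

References: [GreenbergVatsal2000] §2 Prop. 2.1, Cor. 2.3 (pp. 17–21); [GreenbergLNM1716] §4 Lemma 4.2; [Agboola2007] §3 Prop. 3.2.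
-/

noncomputable section

open scoped Classical
-- the summit namespace `Summit.BirchSwinnertonDyer.BirchSwinnertonDyer` repeats the problem name by design (D-0017)
set_option linter.dupNamespace false
set_option autoImplicit false

open NumberField IsDedekindDomain Field
open Literature.NumberTheory.EllipticCurves Literature.NumberTheory.EllipticCurves.GreenbergSelmer
open Literature.NumberTheory.EllipticCurves.GreenbergVatsal2000 Literature.NumberTheory.EllipticCurves.KellerYin2024
open Literature.NumberTheory.EllipticCurves.Agboola2007
open Literature.NumberTheory.EllipticCurves.IwasawaAlgebra Literature.NumberTheory.EllipticCurves.IwasawaDual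
open Literature.NumberTheory.GaloisRepresentations

universe u

namespace Summit.BirchSwinnertonDyer.BirchSwinnertonDyer.Theorems.PrintCf2.StrictDefect

/-! ## §1. Groups: an infinite subgroup of a Prüfer-like group is everything -/

section Groups

variable {Q H : Type*} [AddCommGroup Q] [AddCommGroup H]

/-- **A `p`-primary group with cyclic `p`-torsion is Prüfer-like**: every infinite subgroup is `⊤` (-w2 g10's
`CMPrimes.le_of_not_finite_of_cyclic_torsion` at `G = ⊤`) — the shape of the hypothesis `hH` below for `H = Def ≅ W*` (class (iii)).
[cite: Agboola2007, Lemma 6.3 (b), Prop. 6.11 (arXiv p0014:L1–20)] -/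
theorem eq_top_of_not_finite_of_cyclic_torsion {p : ℕ} (hp : 0 < p) (hprim : ∀ h : H, ∃ n : ℕ, p ^ n • h = 0)
    (hcyc : ∀ x y : H, p • x = 0 → p • y = 0 → x ≠ 0 → ∃ m : ℤ, y = m • x) (A : AddSubgroup H) (hA : ¬ Finite A) : A = ⊤ :=
  top_le_iff.mp (CMPrimes.le_of_not_finite_of_cyclic_torsion hp ⊤ A le_top (fun g _ ↦ hprim g)
    (fun x _ y _ hx hy hx0 ↦ hcyc x y hx hy hx0) hA)

/-- **An equivariant embedding of an INFINITE group into a Prüfer-like group is onto.** If every infinite subgroup of `H` is `⊤` (e.g.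
`H ≅ ℚ_p/ℤ_p`: `p`-primary with cyclic `p`-torsion, -w2 g10 `le_of_not_finite_of_cyclic_torsion`) and `j : Q ↪ H` is injective with `Q`
infinite, then `j` is bijective (`j(Q)` is an infinite subgroup). [cite: GreenbergVatsal2000, §2 Cor. 2.3 (pp. 20–21)] -/
theorem bijective_of_injective_of_not_finite (j : Q →+ H) (hj : Function.Injective j)
    (hH : ∀ A : AddSubgroup H, ¬ Finite A → A = ⊤) (hQ : ¬ Finite Q) : Function.Bijective j := by
  refine ⟨hj, fun h ↦ ?_⟩
  have hrange : ¬ Finite j.range := fun hfin ↦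
    hQ (Finite.of_equiv _ (AddMonoidHom.ofInjective hj).symm.toEquiv)
  have htop := hH j.range hrange
  have hh : h ∈ j.range := by rw [htop]; exact AddSubgroup.mem_top h
  exact hh

/-- **`#Q^{ψ_Q} = #H^{ψ_H}` and `#Q_{ψ_Q} = #H_{ψ_H}` along an equivariant embedding of an infinite `Q` into a Prüfer-like `H`**
(`bijective_of_injective_of_not_finite` + part II `natCard_endInvariants_congr`). [cite: GreenbergVatsal2000, §2 Cor. 2.3 (pp. 20–21)] -/
theorem natCard_endInvariants_eq_of_injective_of_not_finite (j : Q →+ H) (hj : Function.Injective j)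
    (ψQ : AddMonoid.End Q) (ψH : AddMonoid.End H) (hje : ∀ q, j (ψQ q) = ψH (j q))
    (hH : ∀ A : AddSubgroup H, ¬ Finite A → A = ⊤) (hQ : ¬ Finite Q) :
    Nat.card (endInvariants ψQ) = Nat.card (endInvariants ψH) ∧
      Nat.card (EndCoinvariants ψQ) = Nat.card (EndCoinvariants ψH) :=
  natCard_endInvariants_congr (AddEquiv.ofBijective j (bijective_of_injective_of_not_finite j hj hH hQ)) ψQ ψH hje

end Groups

/-! ## §2. The line: `Q` infinite ⟹ `e_δ = χ(H)` for any equivariant Prüfer-like receptacle `H` of `Q = S_nr ⧸ 𝔖` -/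

section Line

variable {K : Type u} [Field K] [NumberField K] {p : ℕ} [Fact p.Prime] {κ : ZpExtension K p}
  {M : Type u} [AddCommGroup M] [DistribMulAction (absoluteGaloisGroup K) M] [TopologicalSpace M] [DiscreteTopology M]
  {𝔮 : HeightOneSpectrum (𝓞 K)} {γ : absoluteGaloisGroup K}

/-- **S3d, INFINITE-DEFECT BRANCH: `Q = S_nr ⧸ 𝔖` infinite and equivariantly embedded in a Prüfer-like `H` ⟹ `ord_p H'(0) = n + χ(H)`.**
Hypotheses of part II's `hasCharValuationAt_restricted_of_unr` (`M` `p`-primary with open stabilisers, `γ` a topological generator of the line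
`κ`, a Greenberg–Vatsal datum `Dnr` of `S_nr` finitely generated torsion with `char = (H')`, `H'(0) ≠ 0`, any Agboola datum `D`), plus: any
abelian group `H` with an endomorphism `ψ_H`, every infinite subgroup of `H` equal to `⊤`, an INJECTIVE additive `j : Q → H` with
`j ∘ ψ_Q = ψ_H ∘ j` (`ψ_Q` induced by `conj_γ − 1`), and `¬ Finite Q`. THEN `D.X` is finitely generated, `D.HasCharValuationAt n`,
`H^{ψ_H}` and `H_{ψ_H}` are finite, `v_p #H^{ψ_H} = e + v_p #H_{ψ_H}` and `ord_p H'(0) = n + e`. On -w6 g4's class (iii) (`H = Def ≅ W*`,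
`#Def^Γ = 4`, `Def_Γ = 0`) this reads `n' = n + 2`; the only arithmetic input is «`Q` infinite».
[cite: GreenbergVatsal2000, §2 Prop. 2.1, Cor. 2.3 (pp. 17–21)] [cite: GreenbergLNM1716, §4 Lemma 4.2] [cite: Agboola2007, §3 Prop. 3.2, §5] -/
theorem hasCharValuationAt_restricted_of_unr_of_injective_of_not_finite (htor : ∀ m : M, ∃ k : ℕ, p ^ k • m = 0)
    (hstab : ∀ m : M, IsOpen (MulAction.stabilizer (absoluteGaloisGroup K) m : Set (absoluteGaloisGroup K)))
    (hγ : κ.IsTopGenerator γ) (Dnr : DatumDualData κ γ M (Castella2018.AcSelmer.bdpData M p 𝔮) ∅)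
    [Module.Finite (IwasawaAlgebra p) Dnr.X] (hXtor : Module.IsTorsion (IwasawaAlgebra p) Dnr.X) {H' : IwasawaAlgebra p}
    (hH' : Module.charIdeal (IwasawaAlgebra p) Dnr.X = Ideal.span {H'}) (hH'0 : PowerSeries.constantCoeff H' ≠ 0)
    (D : RestrictedDualData κ M 𝔮 γ) {H : Type*} [AddCommGroup H] (ψH : AddMonoid.End H)
    (hH : ∀ A : AddSubgroup H, ¬ Finite A → A = ⊤)
    (j : unrSelmer κ M 𝔮 ∅ ⧸ (restrictedSelmerZp κ M 𝔮).addSubgroupOf (unrSelmer κ M 𝔮 ∅) →+ H) (hj : Function.Injective j)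
    (hje : ∀ q, j (QuotientAddGroup.map _ _
        ((conjUnr κ M 𝔮 ∅ γ - 1 : AddMonoid.End (unrSelmer κ M 𝔮 ∅)) : unrSelmer κ M 𝔮 ∅ →+ unrSelmer κ M 𝔮 ∅)
        (addSubgroupOf_le_comap_conjUnr_sub_one κ M 𝔮 γ) q) = ψH (j q))
    (hQ : ¬ Finite (unrSelmer κ M 𝔮 ∅ ⧸ (restrictedSelmerZp κ M 𝔮).addSubgroupOf (unrSelmer κ M 𝔮 ∅))) :
    Module.Finite (IwasawaAlgebra p) D.X ∧
    ∃ (n e : ℕ), D.HasCharValuationAt n ∧ Finite (endInvariants ψH) ∧ Finite (EndCoinvariants ψH) ∧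
      padicValNat p (Nat.card (endInvariants ψH)) = e + padicValNat p (Nat.card (EndCoinvariants ψH)) ∧
      (PowerSeries.constantCoeff H').valuation = n + e :=
  hasCharValuationAt_restricted_of_unr_of_addEquiv htor hstab hγ Dnr hXtor hH' hH'0 D ψH
    (AddEquiv.ofBijective j (bijective_of_injective_of_not_finite j hj hH hQ)) hje

/-- **The class value read off**: under the same hypotheses, if moreover `#H^{ψ_H} = p ^ a` and `H_{ψ_H}` is trivial (`Subsingleton`), then
`ord_p H'(0) = n + a` with `D.HasCharValuationAt n` — for class (iii): `a = 2`. [cite: GreenbergVatsal2000, §2 Cor. 2.3, Prop. 2.4 (pp. 20–22)] -/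
theorem valuation_eq_add_of_injective_of_not_finite (htor : ∀ m : M, ∃ k : ℕ, p ^ k • m = 0)
    (hstab : ∀ m : M, IsOpen (MulAction.stabilizer (absoluteGaloisGroup K) m : Set (absoluteGaloisGroup K)))
    (hγ : κ.IsTopGenerator γ) (Dnr : DatumDualData κ γ M (Castella2018.AcSelmer.bdpData M p 𝔮) ∅)
    [Module.Finite (IwasawaAlgebra p) Dnr.X] (hXtor : Module.IsTorsion (IwasawaAlgebra p) Dnr.X) {H' : IwasawaAlgebra p}
    (hH' : Module.charIdeal (IwasawaAlgebra p) Dnr.X = Ideal.span {H'}) (hH'0 : PowerSeries.constantCoeff H' ≠ 0)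
    (D : RestrictedDualData κ M 𝔮 γ) {H : Type*} [AddCommGroup H] (ψH : AddMonoid.End H)
    (hH : ∀ A : AddSubgroup H, ¬ Finite A → A = ⊤)
    (j : unrSelmer κ M 𝔮 ∅ ⧸ (restrictedSelmerZp κ M 𝔮).addSubgroupOf (unrSelmer κ M 𝔮 ∅) →+ H) (hj : Function.Injective j)
    (hje : ∀ q, j (QuotientAddGroup.map _ _
        ((conjUnr κ M 𝔮 ∅ γ - 1 : AddMonoid.End (unrSelmer κ M 𝔮 ∅)) : unrSelmer κ M 𝔮 ∅ →+ unrSelmer κ M 𝔮 ∅)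
        (addSubgroupOf_le_comap_conjUnr_sub_one κ M 𝔮 γ) q) = ψH (j q))
    (hQ : ¬ Finite (unrSelmer κ M 𝔮 ∅ ⧸ (restrictedSelmerZp κ M 𝔮).addSubgroupOf (unrSelmer κ M 𝔮 ∅)))
    {a : ℕ} (hinv : Nat.card (endInvariants ψH) = p ^ a) (hcoinv : Subsingleton (EndCoinvariants ψH)) :
    Module.Finite (IwasawaAlgebra p) D.X ∧
    ∃ n : ℕ, D.HasCharValuationAt n ∧ (PowerSeries.constantCoeff H').valuation = n + a := by
  obtain ⟨hfin, n, e, h1, -, -, h4, h5⟩ := hasCharValuationAt_restricted_of_unr_of_injective_of_not_finite htor hstab hγ Dnr hXtor hH'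
    hH'0 D ψH hH j hj hje hQ
  haveI := hcoinv
  rw [hinv, Nat.card_of_subsingleton (0 : EndCoinvariants ψH), padicValNat_one_right, add_zero, padicValNat.prime_pow] at h4
  exact ⟨hfin, n, h1, by rw [h5, h4]⟩

end Line

/-! ## §3. The CM summand `W* = V.endEigenPrimaryTorsion p π r` -/

section Summand

variable {K : Type u} [Field K] [NumberField K] (V : WeierstrassCurve K) {p : ℕ} [Fact p.Prime] (π : V.endRing) (r : ℤ_[p])
  {κ : ZpExtension K p} {𝔮 : HeightOneSpectrum (𝓞 K)} {γ : absoluteGaloisGroup K}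

/-- **Infinite-defect branch for the CM summand** (`htor`/`hstab` discharged as in part II): spine hypotheses + Prüfer-like receptacle `H` of
`Q = S_{W*}(K'_∞) ⧸ 𝔖_𝔮(K'_∞, W*)` + `Q` infinite + `#H^{ψ_H} = p ^ a`, `H_{ψ_H}` trivial ⟹ every Agboola datum `D` has `Module.Finite`,
`D.HasCharValuationAt n` and `ord_p H'(0) = n + a` (class (iii): `a = 2`). [cite: GreenbergVatsal2000, §2 Cor. 2.3, Prop. 2.4]
[cite: GreenbergLNM1716, §4 Lemma 4.2] -/
theorem valuation_eq_add_of_injective_of_not_finite_endEigenPrimaryTorsion (hγ : κ.IsTopGenerator γ)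
    (Dnr : DatumDualData κ γ ↥(V.endEigenPrimaryTorsion p π r)
      (Castella2018.AcSelmer.bdpData ↥(V.endEigenPrimaryTorsion p π r) p 𝔮) ∅)
    [Module.Finite (IwasawaAlgebra p) Dnr.X] (hXtor : Module.IsTorsion (IwasawaAlgebra p) Dnr.X) {H' : IwasawaAlgebra p}
    (hH' : Module.charIdeal (IwasawaAlgebra p) Dnr.X = Ideal.span {H'}) (hH'0 : PowerSeries.constantCoeff H' ≠ 0)
    (D : RestrictedDualData κ ↥(V.endEigenPrimaryTorsion p π r) 𝔮 γ) {H : Type*} [AddCommGroup H] (ψH : AddMonoid.End H)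
    (hH : ∀ A : AddSubgroup H, ¬ Finite A → A = ⊤)
    (j : unrSelmer κ ↥(V.endEigenPrimaryTorsion p π r) 𝔮 ∅ ⧸
        (restrictedSelmerZp κ ↥(V.endEigenPrimaryTorsion p π r) 𝔮).addSubgroupOf (unrSelmer κ ↥(V.endEigenPrimaryTorsion p π r) 𝔮 ∅) →+ H)
    (hj : Function.Injective j)
    (hje : ∀ q, j (QuotientAddGroup.map _ _
        ((conjUnr κ ↥(V.endEigenPrimaryTorsion p π r) 𝔮 ∅ γ - 1 : AddMonoid.End (unrSelmer κ ↥(V.endEigenPrimaryTorsion p π r) 𝔮 ∅)) :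
          unrSelmer κ ↥(V.endEigenPrimaryTorsion p π r) 𝔮 ∅ →+ unrSelmer κ ↥(V.endEigenPrimaryTorsion p π r) 𝔮 ∅)
        (addSubgroupOf_le_comap_conjUnr_sub_one κ ↥(V.endEigenPrimaryTorsion p π r) 𝔮 γ) q) = ψH (j q))
    (hQ : ¬ Finite (unrSelmer κ ↥(V.endEigenPrimaryTorsion p π r) 𝔮 ∅ ⧸
        (restrictedSelmerZp κ ↥(V.endEigenPrimaryTorsion p π r) 𝔮).addSubgroupOf (unrSelmer κ ↥(V.endEigenPrimaryTorsion p π r) 𝔮 ∅)))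
    {a : ℕ} (hinv : Nat.card (endInvariants ψH) = p ^ a) (hcoinv : Subsingleton (EndCoinvariants ψH)) :
    Module.Finite (IwasawaAlgebra p) D.X ∧
    ∃ n : ℕ, D.HasCharValuationAt n ∧ (PowerSeries.constantCoeff H').valuation = n + a :=
  valuation_eq_add_of_injective_of_not_finite (RestrictedSelmerPair.exists_pow_smul_endEigenPrimaryTorsion_eq_zero V p π r)
    (RestrictedSelmerPair.isOpen_stabilizer_endEigenPrimaryTorsion V p π r) hγ Dnr hXtor hH' hH'0 D ψH hH j hj hje hQ hinv hcoinv

end Summand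

end Summit.BirchSwinnertonDyer.BirchSwinnertonDyer.Theorems.PrintCf2.StrictDefect

end
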